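import Summits.ResolutionOfSingularities.ResolutionOfSingularities.Theorems.WeightedInvariantIota3SigmaRatioAttained
import Summits.ResolutionOfSingularities.ResolutionOfSingularities.Theorems.WeightedInvariantIota3JFlat
import HarnessLib

/-!
# P3c≤3 EXISTENCE, step (EX-red): A σ-ATTAINING PRIMITIVE TWO-FLAG EXISTS AS SOON AS THE LEVELS OF THE MAXIMAL-RATIO REACHED TRIPLES
# ARE BOUNDED (door `HypersurfaceCentreConstruction`, stmt-ResolutionOfSingularities-19897; P3 rung, obligation (o70-a)
# `SigmaMaximiserExistsLE3Body` of res-L1-w43-plan-1's SPEC (Δ12) `JSigmaCanon_sketch.lean`; hand res-D-pv-038)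

Topic: `Summits/ResolutionOfSingularities/ResolutionOfSingularities/Theorems`. Helper for the door item `HypersurfaceCentreConstruction`
(stmt-ResolutionOfSingularities-19897, route `WeightedInvariant`), line `local-engine` (L W4.3), def-free.  A σ-maximiser
(`Iota3.IsSigmaMaximiser`, res-type-061) is a reached admissible triple `(q ; r₁, r₂)` which is lexicographically maximal in (RATIO `r₁/r₂`,
LEVEL `r₁/q`).  The ratio half EXISTS (`RatContact.exists_flagReaches_ratio_max`, p-`…Iota3SigmaRatioAttained`: the maximal rational one-flag
slope `a/b`).  THIS FILE reduces the whole of (EX) to ONE residual statement, the UNIFORM LEVEL BOUND (EX-4):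

    «∃ L, every two-flag reaching a maximal-ratio admissible triple `(q ; r₁, r₂)` has `r₁ ≤ L q`»

— given it, a σ-attaining PRIMITIVE two-flag exists (`exists_isSigmaMaximiser_of_levelBound`).  Route: at the maximal ratio `a/b` the
membership `f ∈ flagContactFiltration g₁ g₂ q r₁ r₂ (r₁ν)` depends on the triple only through the integers `⌈r₂ m / (b q)⌉`, `m ≤ aν`
(`flagContactFiltration_ratio_eq_of_ceilDiv_eq`, after the scaling `x ⌈/⌉ q = (b x) ⌈/⌉ (b q)`); by the small-denominator lemma of (EX-1)
(`RatContact.exists_ceilDiv_eq_of_denom_le`) every such triple is dominated IN LEVEL by a reached maximal-ratio triple `(Q ; t a, t b)` with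
`Q ≤ aν`, and the level bound makes `t ≤ Lν`: the dominating triples form a FINITE set, a level-maximal member is a σ-maximiser, and dividing
by the gcd makes it primitive (`IsSigmaMaximiser.of_scale`).

* §1 scaling: `ceilDiv_mul_left`, `flagContactFiltration_scale`, `IsSigmaMaximiser.of_scale`, `isPrimitiveTriple_div_gcd`.
* §2 `flagContactFiltration_ratio_eq_of_ceilDiv_eq` — discreteness at a fixed ratio.
* §3 **`exists_isSigmaMaximiser_of_levelBound`** — (EX) ⟸ (EX-2) ✓ + (EX-4).

[OURS · L1 W4.3 · (o70-a) step (EX-red)]  Replaces the role of NO printed item; NOT a statement of the manuscript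
[claim: Hironaka2017, status: under-review]. AI work, weaker than expert review.  Pure commutative algebra; no named facts.

## References

* H. Hironaka, *Characteristic polyhedra of singularities*, J. Math. Kyoto Univ. 7 (1967), §1. [Hironaka1967]
* D. Abramovich, M. Temkin, J. Włodarczyk, *Functorial embedded resolution via weighted blowings up*, Algebra & Number Theory 18 (2024), §5
  (the invariant `(a₁, a₂, a₃)` and its centre). [AbramovichTemkinWlodarczyk2024]
* res-L1-w43-plan-1, SPEC (Δ12) `JSigmaCanon_sketch.lean` aceffaa8e08fb006 (OURS, AI planning).
-/

noncomputable section

open IsLocalRing Literature.AlgebraicGeometry.Resolution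
open Summit.ResolutionOfSingularities.ResolutionOfSingularities.Theorems

set_option linter.dupNamespace false -- mandated namespace of this single-conjunct summit

namespace Summit.ResolutionOfSingularities.ResolutionOfSingularities.Cruxes.HypersurfaceCentreConstruction.LocalEngine

namespace Iota3

namespace RatContact

variable {S : Type} [CommRing S]

/-! ## §1 Scaling of weight triples -/

/-- `⌈d x / (d q)⌉ = ⌈x / q⌉` for `0 < d`, `0 < q`. [folklore] -/
theorem ceilDiv_mul_left {x q d : ℕ} (hd : 0 < d) (hq : 0 < q) : (d * x) ⌈/⌉ (d * q) = x ⌈/⌉ q := by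
  have hdq : 0 < d * q := Nat.mul_pos hd hq
  apply le_antisymm
  · rw [ceilDiv_le_iff_le_smul hdq, smul_eq_mul, mul_assoc]
    exact Nat.mul_le_mul_left d (le_mul_ceilDiv hq)
  · rw [ceilDiv_le_iff_le_smul hq, smul_eq_mul]
    have h := le_mul_ceilDiv (a := d * x) hdq
    rw [mul_assoc] at h
    exact Nat.le_of_mul_le_mul_left h hd

/-- **Scaling a weight triple does not change the filtration** (read at scaled levels):
`flagContactFiltration g₁ g₂ (d q) (d r₁) (d r₂) (d n) = flagContactFiltration g₁ g₂ q r₁ r₂ n`. [folklore] -/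
theorem flagContactFiltration_scale [IsLocalRing S] (g₁ g₂ : S) {q d : ℕ} (hq : 0 < q) (hd : 0 < d) (r₁ r₂ n : ℕ) :
    flagContactFiltration g₁ g₂ (d * q) (d * r₁) (d * r₂) (d * n) = flagContactFiltration g₁ g₂ q r₁ r₂ n := by
  rw [flagContactFiltration_def, flagContactFiltration_def]
  refine iSup_congr fun α => iSup_congr fun β => ?_
  congr 2
  rw [← Nat.ceilDiv_eq_add_pred_div, ← Nat.ceilDiv_eq_add_pred_div, mul_assoc, mul_assoc, ← mul_tsub, ← mul_tsub,
    ceilDiv_mul_left hd hq]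

/-- **A σ-maximiser at a scaled triple is a σ-maximiser at the triple** (the lex conditions and the membership are scale-invariant).
[folklore] -/
theorem IsSigmaMaximiser.of_scale [IsLocalRing S] {f : S} {ν : ℕ} {g₁ g₂ : S} {q r₁ r₂ d : ℕ} (hd : 0 < d)
    (h : IsSigmaMaximiser f ν g₁ g₂ (d * q) (d * r₁) (d * r₂)) : IsSigmaMaximiser f ν g₁ g₂ q r₁ r₂ := by
  obtain ⟨⟨hq, hqr, hrr⟩, hfl, hmem, hlex⟩ := h
  have hq' : 0 < q := Nat.pos_of_ne_zero fun h0 => by rw [h0, mul_zero] at hq; exact lt_irrefl 0 hq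
  refine ⟨⟨hq', Nat.le_of_mul_le_mul_left hqr hd, Nat.le_of_mul_le_mul_left hrr hd⟩, hfl, ?_, fun q' r₁' r₂' hadm hreach => ?_⟩
  · rw [show d * r₁ * ν = d * (r₁ * ν) by ring, flagContactFiltration_scale g₁ g₂ hq' hd] at hmem
    exact hmem
  · rcases hlex q' r₁' r₂' hadm hreach with hlt | ⟨heq, hle⟩
    · left
      have : d * (r₁' * r₂) < d * (r₁ * r₂') := by
        calc d * (r₁' * r₂) = r₁' * (d * r₂) := by ring
          _ < d * r₁ * r₂' := hlt
          _ = d * (r₁ * r₂') := by ring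
      exact Nat.lt_of_mul_lt_mul_left this
    · right
      constructor
      · have : d * (r₁' * r₂) = d * (r₁ * r₂') := by
          calc d * (r₁' * r₂) = r₁' * (d * r₂) := by ring
            _ = d * r₁ * r₂' := heq
            _ = d * (r₁ * r₂') := by ring
        exact Nat.eq_of_mul_eq_mul_left hd this
      · have : d * (r₁' * q) ≤ d * (r₁ * q') := by
          calc d * (r₁' * q) = r₁' * (d * q) := by ring
            _ ≤ d * r₁ * q' := hle
            _ = d * (r₁ * q') := by ring
        exact Nat.le_of_mul_le_mul_left this hd

/-- **Dividing by the gcd gives a primitive triple.** [folklore] -/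
theorem isPrimitiveTriple_div_gcd {q r₁ r₂ : ℕ} (hq : 0 < q) :
    IsPrimitiveTriple (q / Nat.gcd q (Nat.gcd r₁ r₂)) (r₁ / Nat.gcd q (Nat.gcd r₁ r₂)) (r₂ / Nat.gcd q (Nat.gcd r₁ r₂)) := by
  set d := Nat.gcd q (Nat.gcd r₁ r₂) with hd
  have hdq : d ∣ q := Nat.gcd_dvd_left _ _
  have hd₁ : d ∣ r₁ := (Nat.gcd_dvd_right _ _).trans (Nat.gcd_dvd_left _ _)
  have hd₂ : d ∣ r₂ := (Nat.gcd_dvd_right _ _).trans (Nat.gcd_dvd_right _ _)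
  have hdpos : 0 < d := Nat.pos_of_dvd_of_pos hdq hq
  intro e heq he₁ he₂
  have h1 : e * d ∣ q := by rw [← Nat.div_mul_cancel hdq]; exact Nat.mul_dvd_mul_right heq d
  have h2 : e * d ∣ r₁ := by rw [← Nat.div_mul_cancel hd₁]; exact Nat.mul_dvd_mul_right he₁ d
  have h3 : e * d ∣ r₂ := by rw [← Nat.div_mul_cancel hd₂]; exact Nat.mul_dvd_mul_right he₂ d
  have h4 : e * d ∣ d := Nat.dvd_gcd h1 (Nat.dvd_gcd h2 h3)
  have h5 : e * d ≤ 1 * d := by rw [one_mul]; exact Nat.le_of_dvd hdpos h4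
  have he : e ≤ 1 := Nat.le_of_mul_le_mul_right h5 hdpos
  have hqd : 0 < q / d := Nat.div_pos (Nat.le_of_dvd hq hdq) hdpos
  have he0 : e ≠ 0 := by
    rintro rfl
    rw [zero_dvd_iff] at heq
    omega
  omega

/-! ## §2 Discreteness at a fixed ratio -/

/-- The level-`r₁ν` exponents at ratio `a/b` (`r₁ b = a r₂`): `⌈(r₁ν − r₁α − r₂β)/q⌉ = ⌈r₂ (aν − aα − bβ) / (b q)⌉`. [folklore] -/
theorem ceilDiv_ratio_eq {a b q r₁ r₂ : ℕ} (hb : 0 < b) (hq : 0 < q) (hrat : r₁ * b = a * r₂) (ν α β : ℕ) :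
    (r₁ * ν - r₁ * α - r₂ * β) ⌈/⌉ q = (r₂ * (a * ν - a * α - b * β)) ⌈/⌉ (b * q) := by
  rw [← ceilDiv_mul_left hb hq]
  congr 1
  rw [mul_tsub, mul_tsub, mul_tsub, mul_tsub]
  have h1 : b * (r₁ * ν) = r₂ * (a * ν) := by
    calc b * (r₁ * ν) = r₁ * b * ν := by ring
      _ = a * r₂ * ν := by rw [hrat]
      _ = r₂ * (a * ν) := by ring
  have h2 : b * (r₁ * α) = r₂ * (a * α) := by
    calc b * (r₁ * α) = r₁ * b * α := by ring
      _ = a * r₂ * α := by rw [hrat]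
      _ = r₂ * (a * α) := by ring
  have h3 : b * (r₂ * β) = r₂ * (b * β) := by ring
  rw [h1, h2, h3]

/-- **At a fixed ratio `a/b` the membership depends on the triple only through `(⌈r₂ m / (b q)⌉)_{m ≤ aν}`**: two maximal-ratio triples
`(q ; r₁, r₂)`, `(q' ; r₁', r₂')` (`r₁ b = a r₂`, `r₁' b = a r₂'`) with `⌈r₂' m/(b q')⌉ = ⌈r₂ m/(b q)⌉` for all `m ≤ aν` give the same filtration
at their respective levels `r₁ν`, `r₁'ν`. [OURS · L1 W4.3 · (EX-red)] -/
theorem flagContactFiltration_ratio_eq_of_ceilDiv_eq [IsLocalRing S] (g₁ g₂ : S) {a b q r₁ r₂ q' r₁' r₂' ν : ℕ} (hb : 0 < b)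
    (hq : 0 < q) (hq' : 0 < q') (hrat : r₁ * b = a * r₂) (hrat' : r₁' * b = a * r₂')
    (h : ∀ m ≤ a * ν, (r₂' * m) ⌈/⌉ (b * q') = (r₂ * m) ⌈/⌉ (b * q)) :
    flagContactFiltration g₁ g₂ q' r₁' r₂' (r₁' * ν) = flagContactFiltration g₁ g₂ q r₁ r₂ (r₁ * ν) := by
  rw [flagContactFiltration_def, flagContactFiltration_def]
  refine iSup_congr fun α => iSup_congr fun β => ?_
  congr 2
  rw [← Nat.ceilDiv_eq_add_pred_div, ← Nat.ceilDiv_eq_add_pred_div, ceilDiv_ratio_eq hb hq' hrat', ceilDiv_ratio_eq hb hq hrat]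
  exact h _ ((Nat.sub_le _ _).trans (Nat.sub_le _ _))

/-! ## §3 (EX) from the uniform level bound -/

/-- **A σ-ATTAINING PRIMITIVE TWO-FLAG EXISTS, GIVEN THE UNIFORM LEVEL BOUND.**  `S` an excellent regular local ring of dimension `3`,
`0 ≠ f ∈ 𝔪²` not of monomial type, `ν = ord f`.  Hypothesis (EX-4): some `L` bounds `r₁ ≤ L q` for every two-flag `(g₁, g₂)` reaching an admissible
triple `(q ; r₁, r₂)` WHOSE RATIO IS MAXIMAL among the reached admissible triples.  Conclusion: some two-flag with a PRIMITIVE admissible triple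
is a σ-maximiser (`Iota3.IsSigmaMaximiser`), i.e. `Iota3.SigmaMaximiserExistsAt f` of SPEC (Δ12) spelled out. [OURS · L1 W4.3 · (o70-a) (EX-red)] -/
theorem exists_isSigmaMaximiser_of_levelBound [IsRegularLocalRing S] (hS : IsExcellentRing S) (hdim : ringKrullDim S = 3) {f : S}
    (hf0 : f ≠ 0) (hf2 : f ∈ maximalIdeal S ^ 2) (hnm : ¬ IsMonomialType f) (L : ℕ)
    (hL : ∀ (g₁ g₂ : S) (q r₁ r₂ : ℕ), AdmissibleTriple q r₁ r₂ → IsTwoFlag g₁ g₂ →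
      f ∈ flagContactFiltration g₁ g₂ q r₁ r₂ (r₁ * (adicOrder f).toNat) →
      (∀ q' r₁' r₂' : ℕ, AdmissibleTriple q' r₁' r₂' → FlagReaches f (adicOrder f).toNat q' r₁' r₂' → r₁' * r₂ ≤ r₁ * r₂') →
      r₁ ≤ L * q) :
    ∃ (g₁ g₂ : S) (q r₁ r₂ : ℕ), IsSigmaMaximiser f (adicOrder f).toNat g₁ g₂ q r₁ r₂ ∧ IsPrimitiveTriple q r₁ r₂ := by
  classical
  set ν := (adicOrder f).toNat with hνdef
  -- (EX-2): the maximal ratio `a/b`, reached by a two-flag at the triple `(b ; a, b)`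
  obtain ⟨g₁o, g₂o, a, b, hadm₀, hfl₀, hmem₀, hrat⟩ := exists_flagReaches_ratio_max hS hdim hf0 hf2 hnm
  have hb : 0 < b := hadm₀.1
  have hba : b ≤ a := hadm₀.2.2
  have ha : 0 < a := lt_of_lt_of_le hb hba
  -- the order `ν ≥ 1`
  have h𝔪 : maximalIdeal S ≠ ⊥ := by
    intro h; apply hf0
    have : f ∈ maximalIdeal S := Ideal.pow_le_self two_ne_zero hf2
    rw [h] at this; exact (Submodule.mem_bot S).mp this
  obtain ⟨ν', -, hνeq, hν1, -, -⟩ := exists_adicOrder_eq_of_not_isMonomialType hf0 hnm (exists_mem_maximalIdeal_not_mem_sq h𝔪)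
  have hν : 0 < ν := by rw [hνdef, hνeq]; exact hν1
  have haν : 0 < a * ν := Nat.mul_pos ha hν
  -- maximal-ratio triples scaled from `(b ; a, b)` keep the maximal-ratio property
  have hratT : ∀ t : ℕ, 0 < t → ∀ q' r₁' r₂' : ℕ, AdmissibleTriple q' r₁' r₂' → FlagReaches f ν q' r₁' r₂' →
      r₁' * (t * b) ≤ t * a * r₂' := by
    intro t _ q' r₁' r₂' hadm' hreach'
    calc r₁' * (t * b) = t * (r₁' * b) := by ring
      _ ≤ t * (a * r₂') := Nat.mul_le_mul_left t (hrat q' r₁' r₂' hadm' hreach')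
      _ = t * a * r₂' := by ring
  -- the finite dominating set: pairs `(t, Q)`, `0 < Q ≤ aν`, `Q ≤ t b`, `t ≤ L ν`, `(Q ; t a, t b)` reached by a two-flag
  set M : Set (ℕ × ℕ) := {p | 0 < p.2 ∧ p.2 ≤ a * ν ∧ p.2 ≤ p.1 * b ∧ p.1 ≤ L * ν ∧
      ∃ h₁ h₂ : S, IsTwoFlag h₁ h₂ ∧ f ∈ flagContactFiltration h₁ h₂ p.2 (p.1 * a) (p.1 * b) (p.1 * a * ν)} with hM
  have hMfin : M.Finite := by
    refine ((Set.finite_Iic (L * ν)).prod (Set.finite_Iic (a * ν))).subset ?_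
    rintro ⟨t, Q⟩ ⟨-, hQ, -, ht, -⟩
    exact ⟨ht, hQ⟩
  -- every two-flag reaching a maximal-ratio triple is dominated in level by a member of `M`
  have hdom : ∀ (h₁ h₂ : S) (q r₁ r₂ : ℕ), AdmissibleTriple q r₁ r₂ → IsTwoFlag h₁ h₂ →
      f ∈ flagContactFiltration h₁ h₂ q r₁ r₂ (r₁ * ν) → r₁ * b = a * r₂ →
      ∃ p ∈ M, r₁ * p.2 ≤ p.1 * a * q := by
    intro h₁ h₂ q r₁ r₂ hadm hfl hmem hratq
    have hq : 0 < q := hadm.1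
    have hbq : 0 < b * q := Nat.mul_pos hb hq
    obtain ⟨t, Q, hQ, hQaν, hdomQ, hvec⟩ := exists_ceilDiv_eq_of_denom_le (a := r₂) hbq haν
    -- the dominating maximal-ratio triple `(Q ; t a, t b)`
    have hratT' : t * a * b = a * (t * b) := by ring
    have hmemT : f ∈ flagContactFiltration h₁ h₂ Q (t * a) (t * b) (t * a * ν) := by
      rw [flagContactFiltration_ratio_eq_of_ceilDiv_eq h₁ h₂ hb hq hQ hratq hratT' (fun m hm => ?_)]
      · exact hmem
      · rw [show t * b * m = b * (t * m) by ring, ceilDiv_mul_left hb hQ]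
        exact hvec m hm
    have hQtb : Q ≤ t * b := by
      -- `q Q ≤ r₂ Q ≤ t b q`
      have h1 : q * Q ≤ r₂ * Q := Nat.mul_le_mul_right Q hadm.2.1
      have h2 : r₂ * Q ≤ t * (b * q) := hdomQ
      have h3 : q * Q ≤ q * (t * b) := by
        calc q * Q ≤ t * (b * q) := h1.trans h2
          _ = q * (t * b) := by ring
      exact Nat.le_of_mul_le_mul_left h3 hq
    have htpos : 0 < t := by
      rcases Nat.eq_zero_or_pos t with rfl | h
      · rw [zero_mul] at hQtb; exact absurd hQtb (not_le.mpr hQ)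
      · exact h
    have hadmT : AdmissibleTriple Q (t * a) (t * b) := ⟨hQ, hQtb, Nat.mul_le_mul_left t hba⟩
    have htL : t ≤ L * ν := by
      have h := hL h₁ h₂ Q (t * a) (t * b) hadmT hfl hmemT (hratT t htpos)
      -- `t a ≤ L Q ≤ L a ν`
      have h2 : a * t ≤ a * (L * ν) := by
        calc a * t = t * a := mul_comm _ _
          _ ≤ L * Q := h
          _ ≤ L * (a * ν) := Nat.mul_le_mul_left L hQaν
          _ = a * (L * ν) := by ring
      exact Nat.le_of_mul_le_mul_left h2 ha
    refine ⟨(t, Q), ⟨hQ, hQaν, hQtb, htL, h₁, h₂, hfl, hmemT⟩, ?_⟩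
    -- level: `r₁ Q ≤ t a q` from `b r₁ Q = a r₂ Q ≤ a t b q`
    have h4 : b * (r₁ * Q) ≤ b * (t * a * q) := by
      calc b * (r₁ * Q) = r₁ * b * Q := by ring
        _ = a * r₂ * Q := by rw [hratq]
        _ = a * (r₂ * Q) := by ring
        _ ≤ a * (t * (b * q)) := Nat.mul_le_mul_left a hdomQ
        _ = b * (t * a * q) := by ring
    exact Nat.le_of_mul_le_mul_left h4 hb
  -- `M` is non-empty: the dominator of `(b ; a, b)`
  obtain ⟨p₀, hp₀M, -⟩ := hdom g₁o g₂o b a b hadm₀ hfl₀ hmem₀ rfl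
  have hMne : hMfin.toFinset.Nonempty := ⟨p₀, hMfin.mem_toFinset.mpr hp₀M⟩
  -- a level-maximal member
  obtain ⟨p, hpM, hmax⟩ := Finset.exists_max_image hMfin.toFinset (fun p : ℕ × ℕ => ((p.1 : ℕ) : ℚ) / p.2) hMne
  obtain ⟨hpQ, -, hpQtb, -, h₁, h₂, hfl, hmemp⟩ := hMfin.mem_toFinset.mp hpM
  have htpos : 0 < p.1 := by
    rcases Nat.eq_zero_or_pos p.1 with h0 | h
    · rw [h0, zero_mul] at hpQtb; exact absurd hpQtb (not_le.mpr hpQ)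
    · exact h
  -- it is a σ-maximiser at the triple `(p.2 ; p.1 a, p.1 b)`
  have hσ : IsSigmaMaximiser f ν h₁ h₂ p.2 (p.1 * a) (p.1 * b) := by
    refine ⟨⟨hpQ, hpQtb, Nat.mul_le_mul_left _ hba⟩, hfl, hmemp, fun q' r₁' r₂' hadm' hreach' => ?_⟩
    have hle := hrat q' r₁' r₂' hadm' hreach'
    rcases hle.lt_or_eq with hlt | heq
    · left
      calc r₁' * (p.1 * b) = p.1 * (r₁' * b) := by ring
        _ < p.1 * (a * r₂') := Nat.mul_lt_mul_of_pos_left hlt htpos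
        _ = p.1 * a * r₂' := by ring
    · right
      refine ⟨by rw [show r₁' * (p.1 * b) = p.1 * (r₁' * b) by ring, heq]; ring, ?_⟩
      -- a maximal-ratio reached triple: dominated by some `p' ∈ M`, itself below `p`
      obtain ⟨h₁', h₂', hfl', hmem'⟩ := hreach'
      obtain ⟨p', hp'M, hdom'⟩ := hdom h₁' h₂' q' r₁' r₂' hadm' hfl' hmem' heq
      have hp'Q : 0 < p'.2 := hp'M.1
      have h1 := hmax p' (hMfin.mem_toFinset.mpr hp'M)
      rw [div_le_div_iff₀ (by exact_mod_cast hp'Q) (by exact_mod_cast hpQ)] at h1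
      have h1' : p'.1 * p.2 ≤ p.1 * p'.2 := by exact_mod_cast h1
      have h2 : r₁' * p.2 * p'.2 ≤ p.1 * a * q' * p'.2 := by
        calc r₁' * p.2 * p'.2 = r₁' * p'.2 * p.2 := by ring
          _ ≤ p'.1 * a * q' * p.2 := Nat.mul_le_mul_right _ hdom'
          _ = p'.1 * p.2 * (a * q') := by ring
          _ ≤ p.1 * p'.2 * (a * q') := Nat.mul_le_mul_right _ h1'
          _ = p.1 * a * q' * p'.2 := by ring
      exact Nat.le_of_mul_le_mul_right h2 hp'Q
  -- divide by the gcd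
  set d := Nat.gcd p.2 (Nat.gcd (p.1 * a) (p.1 * b)) with hd
  have hdq : d ∣ p.2 := Nat.gcd_dvd_left _ _
  have hd₁ : d ∣ p.1 * a := (Nat.gcd_dvd_right _ _).trans (Nat.gcd_dvd_left _ _)
  have hd₂ : d ∣ p.1 * b := (Nat.gcd_dvd_right _ _).trans (Nat.gcd_dvd_right _ _)
  have hdpos : 0 < d := Nat.pos_of_dvd_of_pos hdq hpQ
  refine ⟨h₁, h₂, p.2 / d, p.1 * a / d, p.1 * b / d, IsSigmaMaximiser.of_scale hdpos ?_, isPrimitiveTriple_div_gcd hpQ⟩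
  rw [Nat.mul_div_cancel' hdq, Nat.mul_div_cancel' hd₁, Nat.mul_div_cancel' hd₂]
  exact hσ

end RatContact

end Iota3

end Summit.ResolutionOfSingularities.ResolutionOfSingularities.Cruxes.HypersurfaceCentreConstruction.LocalEngine

end
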